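import Summits.CriticalPhenomena.SAWScalingLimit.Theses.SAWCompassLattice
import Summits.CriticalPhenomena.SAWScalingLimit.Theorems.SAWDevelopingMapHexTransferPortTransfer
import Summits.CriticalPhenomena.SAWScalingLimit.Theorems.SAWDevelopingMapHexTransferPortDictionary
import Summits.CriticalPhenomena.SAWScalingLimit.Theorems.SAWCompassLatticeCompassSLEYbCriterion
import Summits.CriticalPhenomena.SAWScalingLimit.Theorems.SAWCompassLatticeCompassSLEYbAvoidancePassage
import Summits.CriticalPhenomena.SAWScalingLimit.Theorems.SAWCompassLatticeCompassSLEYbTightOfTraversalBound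
import Summits.CriticalPhenomena.SAWScalingLimit.Theorems.SAWCompassLatticeCompassSLEYbSubseqLimitChordal
import Summits.CriticalPhenomena.SAWScalingLimit.Theorems.SAWLoopFugacityFlowSimpleSubseqLimitsStubRangeIsArcBoundary
import Summits.CriticalPhenomena.SAWScalingLimit.Theorems.SAWLoopFugacityFlowAvoidanceDeterminesLaw
import Summits.CriticalPhenomena.SAWScalingLimit.Theorems.SAWLoopFugacityFlowSLECarrier
import Summits.CriticalPhenomena.SAWScalingLimit.Theorems.SAWSteinDefectSLEAvoidanceValue
import Literature.Probability.RandomPlanarGeometry.SLEConvergenceCriterion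
import Literature.Probability.RandomPlanarGeometry.SLEExistenceNeEightHolds
import Literature.Probability.RandomPlanarGeometry.CaratheodoryHalfPlaneProofs
import Literature.Probability.RandomPlanarGeometry.RestrictionHullsRiemannProofs
import Literature.Probability.RandomPlanarGeometry.RestrictionHullsProofs
import Literature.Probability.RandomPlanarGeometry.HullSubdomainPullback
import Literature.Probability.RandomPlanarGeometry.JordanDomainProofs
import Literature.Probability.RandomPlanarGeometry.CurveTightness
import Summits.CriticalPhenomena.SAWScalingLimit.Theorems.SAWCompassLatticeCompassSLEExact
import Summits.CriticalPhenomena.SAWScalingLimit.Theorems.SAWCompassLatticeCompassSLEYbDomainRestriction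
import Summits.CriticalPhenomena.SAWScalingLimit.Theorems.SAWCompassLatticeCompassSLEYbSubseqLimitClosureSimple

/-!
# Skeleton v6 (lead c6) for the crux `CompassSLE` (stmt-CriticalPhenomena-6965, route SAWCompassLattice),
# line `registered` (= `birth`)

v6 (lead c6, 2026-08-17) = v5 with the SAME three open stubs T1 `stub_ybTraversalBound`, I1
`stub_ybRestrictionLaw`, I2b `stub_ybSubseqLimitSimple` (signatures byte-identical, still the only `sorry`s)
plus two CLOSED pieces landed by c6 that split off the provable LATTICE halves of I1 and I2b (section
"Closed pieces landed by lead c6" below; both `--supports` stmt-6965, registered with `stub-add`):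
* I1-lattice `stub_ybRestrictionSandwich` (`Theorems/…CompassSLEYbDomainRestriction.lean`, p159708): the exact
  domain-restriction (domain-Markov) property of the GM law, `(P_{Ω'})_* = P_Ω( · | γ ⊆ Ω'_δ)`
  (`map_mapDomain_ybLaw`), the restriction formula `P_Ω(γ ⊆ Ω'_δ) = Z(Ω'_δ)/Z(Ω_δ)` and the sandwich
  `G_{Ω'_δ}/G_{Ω_δ} ≤ P_Ω(range ⊆ cl Ω') ≤ G_{(Ω ∩ cthickening 2δ Ω')_δ}/G_{Ω_δ}` — so I1 IS the statement
  `Z(Ω'_δ; a_δ, b_δ)/Z(Ω_δ; a_δ, b_δ) → Φ'_A(0)^{5/8}` about GM two-point functions, up to a `2δ`-thickening;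
* I2b-soft `stub_ybSubseqLimitClosureSimple` (`Theorems/…CompassSLEYbLatticeSimple.lean`): GM `π/2` walks are
  drawn as SIMPLE curves (`LatticeSimple.curve_mem_simple`, via a general polyline simplicity criterion and
  the square-tiling geometry of Fig. 1), hence every probability subsequential limit `ν` is carried by
  `closure CurveClass.simple`; what is left of I2b is `ν(closure simple ∖ simple) = 0` (no self-touching).
The open stubs are unchanged and remain research-open (crux-implied: p151290, p151765, p145875; jointly
crux-equivalent: p152168). v5 text follows.

## v5 (lead c2)

v5 (lead c2, 2026-08-17) = v4 with the SAME three open stubs T1 `stub_ybTraversalBound`, I1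
`stub_ybRestrictionLaw`, I2b `stub_ybSubseqLimitSimple` (signatures byte-identical, the only `sorry`s),
plus the LANDED exactness certificates (last section of this file, all `--supports` stmt-6965):
* crux ⇒ T1: `ybTraversalBound_of_ybSquareSLE` (Le Cam along the mesh via the compact container
  `exists_isCompact_forall_ybCurve_mem` p150069, set-tightness on an initial mesh interval, shell-dependent
  threshold from `exists_forall_not_hasTraversals_of_isCompact`; `Theorems/…YbTightNecessity.lean` p151290);
* crux ⇒ I1: `ybRestrictionLaw_of_ybSquareSLE` (portmanteau sandwich `tendsto_of_sandwich` with the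
  SLE(8/3)-null touching event `sle_measure_diff_avoid_eq_zero` and the value `SLEAvoidanceValue`;
  `Theorems/…YbRestrictionLawNecessity.lean` p151765);
* crux ⇒ I2b, crux ⇒ I: `…StubsNecessary.lean` p145875 (lead c1);
* capstone `compassSLE_iff_stubs : CompassSLE ↔ T1 ∧ I1 ∧ I2b`, `ybSquareSLE_iff_stubs`,
  `ybSquareSLE_iff_tight_and_identification`, `convergesInLawToSLE_yb_iff_tight_and_identification`
  (any κ), and the cross-route reduction `compassSLE_of_trackTransport : AngleUniversality → YBLimitExists →
  AxiomsOfLimit → RStarRot → MirrorRotation → CompassSLE` (the five cruxes of route SAWTrackTransport,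
  stmt-16963/16995/16965/7298/16997) (`Theorems/…CompassSLEExact.lean` p152168);
* I2b ⇐ YBLimitExists ∧ AxiomsOfLimit: `ybSubseqLimitSimple_of_trackTransport`
  (`Theorems/…YbSimpleOfTrackTransport.lean` p149729).
So the split is an EQUIVALENCE: promoting T1, I1, I2b to items loses nothing and adds nothing, and a
refutation of any one of them refutes the crux, `YBSquareSLE` and the route. v4 text follows.

## v4 (lead c1)

`CompassSLE`: for every solution `(α, β, s, z)` of the compass equations, every Dobrushin domain and
every port endpoint approximation at `Θ ≡ π/2`, the honest edge-fugacity SAW on the compass lattice,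
pushed to `CurveClass ℂ`, converges in law to chordal SLE(8/3).

LANDED already: `CompassSLE ↔ YBSquareSLE` (`Theorems/SAWCompassLatticeCompassSLEIffYBSquareSLE.lean`,
p143456: the port transfer `Cruxes.HexTransfer.Sketch.stub_portTransfer` + `stub_portDictionary` one
way, the same `O(δ)` coupling reversed the other way). So the open content is exactly `YBSquareSLE`
(stmt-6967): chordal SLE(8/3) convergence of Glazman–Manolescu's critical `π/2` Yang–Baxter walk —
Duminil-Copin–Smirnov Conjecture 1 transported. v1 (planner, sha ac743d82) split it as
T (`IsTightAlongMesh`) + I (identification of probability subsequential limit laws) + C (the soft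
criterion). v2 keeps C verbatim and RESHAPES the two open halves along the only schemes by which
either half has ever been proved for a lattice interface, down to NAMED standard inputs of exactly the
shapes the sibling `δℤ²` / `δℍ` routes file as items (so each is attackable / refutable on its own and
the glue is provable now):

* T = T1 + T2 (Aizenman–Burchard):
  - T1 `stub_ybTraversalBound` (OPEN): the AB multi-traversal bound for the `π/2` Yang–Baxter curve
    laws — hypothesis (H1) of the PROVED criterion `isTightMeasureSet_of_traversalBounds`
    (`CurveTightness.lean`, AB99 Thms 1.1–1.2), shape copied from the items
    `SAWLeftRightFKG.SAWTraversalBound` (`δℤ²`) / `HexTraversalBound` (`δℍ`). CAVEAT (wave-2 worker T1,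
    kernel-checked in its scratch `t1_of_ybEventualTightSet`, port of
    `Theorems/ShellCrossingBound/Negative/OfEventualTight.lean`): with the SHELL-DEPENDENT threshold `k`
    this shape is implied by set-level eventual tightness (K = 1, λ = 3, via
    `exists_forall_not_hasTraversals_of_isCompact`), so T1 ⇔ T: it is tightness in Aizenman–Burchard
    clothing, the standard interface but NOT an a-priori estimate strictly below the crux; the
    content-bearing cuts on `δℤ²` are the per-interior-shell form `BulkShellTight` (stmt-17588) +
    `ConfinementPositivity` (stmt-17587) of route SAWRenewalTightness (glue to `ShellCrossingBound`
    LANDED there, p138355) — their `π/2` twins `YBBulkShellTight`/`YBConfinementPositivity` are typed in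
    `work/stubs/stub_ybTraversalBound_scratch.lean` and are the recommended promotion targets.
  - T2 `stub_ybTightOfTraversalBound` — LANDED by wave-2 worker T2 (p144902,
    `Theorems/SAWCompassLatticeCompassSLEYbTightOfTraversalBound.lean`, 384 lines: the AB criterion with
    the short-distance cutoff `not_hasTraversals_path` for `π/2` mid-edge polylines, threshold 147, then
    `isTightAlongMesh_of_isTightMeasureSet_image`); kept below as a closed alias.
* I = I1 + I2 + I3 (Lawler–Schramm–Werner restriction programme, arXiv:math/0209343 Lemma 3.2,
  Prop. 3.3, Thm. 6.1; the cut of `Cruxes/HexSubseqIdentification/Lines/birth.lean`, whose composition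
  is ported here verbatim with `hexSAWLaw` ↦ `ybLaw (π/2) … 1`):
  - I1 `stub_ybRestrictionLaw` (OPEN, the conformal content, where `5/8` enters): for every hull
    subdomain `D' ⊆ D` (ε-ball form), chordal uniformizer `φ` and restriction data `(Φ, d)` of
    `φ.pullbackHull D'`, `P^{YB}_δ(range ⊆ closure D') → d^{5/8}` along `𝓝[>] 0` (`π/2` twin of items
    stmt-7147 `HexRestrictionLaw` / stmt-4981 `AvoidanceLimit`; lattice meaning: the GM weights have the
    EXACT domain-restriction property, so this is `Z(Ω'_δ; a, b)/Z(Ω_δ; a, b) → Φ'_A(0)^{5/8}`).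
  - I2 = I2a + I2b (v3 reshape of v2's `stub_ybSimpleSubseqLimits`, after wave-2 worker I2):
    · I2a `stub_ybSubseqLimitChordal` (LANDED, p144900, `Theorems/SAWCompassLatticeCompassSLEYbSubseqLimitChordal.lean`): probability subsequential limit laws are
      carried by chords from `a` to `b` inside `closure D` (portmanteau on closed events; lattice walks
      start at `δ·planeMidpoint (a δ) → a`, end at `→ b`, and lie in `D` once `a δ ≠ b δ`);
    · I2b `stub_ybSubseqLimitSimple` (OPEN, the irreducible lattice regularity estimate, L–XL):
      `ν`-a.e. curve class is SIMPLE (`π/2` twin of the hard core of stmt-7148 / stmt-4982; on `δℤ²`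
      `SimpleSubseqLimits ↔ PastFutureAvoidance` given tightness + avoidance values,
      `FarPast.RouteResidual.crux_iff_pastFutureAvoidance` — research-open there too);
    · the BOUNDARY-AVOIDANCE conjunct of v2's I2 is no longer a stub: it follows in the composition from
      I2a + the avoidance agreement (I1 + I3, which never use `ν`'s carrier) + `SLECarrier_proof` via the
      LANDED lattice-free `…SimpleSubseqLimits.MarkedPointRevisit.ArcRangeBoundary.stub_rangeIsArc_boundary`
      (`Theorems/SAWLoopFugacityFlowSimpleSubseqLimitsStubRangeIsArcBoundary.lean`).
  - I3 `stub_ybAvoidancePassage` — LANDED by wave-2 worker I3 (p144241,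
    `Theorems/SAWCompassLatticeCompassSLEYbAvoidancePassage.lean`, with the model-independent
    `avoidancePassage_of_mass_zero_or_one`): the portmanteau sandwich, `π/2` twin of stmt-7149 / the
    PROVED `δℤ²` stmt-4984; kept below as a closed alias.
* C `stub_ybCriterion` — LANDED by wave-1 worker C (p143596,
  `Theorems/SAWCompassLatticeCompassSLEYbCriterion.lean`); kept below as a closed alias.

Compositions (kernel-checked, no `sorry` of their own): `ybTight_holds : YBTight` from T1, T2;
`ybSubseqIdentification_holds : YBSubseqIdentification` from I1, I2a, I2b, I3 through the PROVED tree theorems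
`exists_isSLECurve_eightThirds`, `Theorems.SLECarrier_proof` (stmt-4985),
`MarkedDomain.exists_isChordalUniformizing_holds`, `IsingBoundaryRatio.Negative.isHullSubdomain_of_conds`,
`IsStarHull.pullbackHull` + `JordanDomain.isSimplyConnected_holds`, `IsStarHull.exists_isRestrictionMap`,
`IsStarHull.exists_hasRestrictionDeriv_holds`, `Theorems.SLEAvoidanceValue_pullbackHull_proof` (stmt-4986),
`Theorems.AvoidanceDeterminesLaw.AvoidanceDeterminesLaw_proof` (stmt-1373), `ArcRangeBoundary.stub_rangeIsArc_boundary`; then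
`ybSquareSLE_of_stubs : YBTight → YBSubseqIdentification → YBCriterion → YBSquareSLE` and
`CompassSLE_of : CompassSLE := stub_portTransfer stub_portDictionary (…)` exactly as in v1.
`sorry` occurs ONLY in the three OPEN `stub_*` theorems T1, I1, I2b (C, T2, I2a, I3 are closed aliases of landed theorems).

What the cut loses: nothing — every stub is a consequence of the crux (T ⇐ YBSquareSLE by Le Cam along
sequences + local finiteness of the walk sets in `δ ∈ [η, δ₀)`; I ⇐ uniqueness of weak limits; I1 ⇐
crux + null boundary of hull-avoidance events under SLE(8/3), `HullRestrictionNull`; I2a/I2b ⇐ crux +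
`SLECarrier`; I3's conclusion ⇐ crux + `IsSLELaw.unique`; T1 ⇐ T (worker T1's `t1_of_ybEventualTightSet`,
see the caveat above) — so EVERY stub is crux-equivalent-or-weaker: an honest equivalence split).

Disproof used: none exists for this crux (`ledger crux ls`: Lines/birth.{lean,md}, PICKED.md). Dead
stubs: none (v1's T and I are not dead, they are refined). Negatives honoured: stmt-0772 (all-δ
`IsTightLaws`) — T1/T2 only speak of `δ ∈ (0, δ₀]` and the eventual `IsTightAlongMesh`.
-/

noncomputable section

namespace Summit.CriticalPhenomena.SAWScalingLimit.Cruxes.CompassSLE.Birth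

open MeasureTheory Filter Topology Set
open scoped NNReal ENNReal
open UpperHalfPlane (upperHalfPlaneSet)
open Literature.Probability.RandomPlanarGeometry
open Literature.Probability.RandomPlanarGeometry.SAW.YangBaxter
open Summit.CriticalPhenomena.SAWScalingLimit.Theses
open Literature.Probability.LatticeModels (polyline)

/-! ## The three v1 statements, named (documentation and composition vocabulary) -/

/-- **(T) Precompactness of GM's critical `π/2` Yang–Baxter walk.** For every Dobrushin domain and
every port endpoint approximation, the curve laws `δ ↦ ybLaw (π/2) Ω δ 1 a_δ b_δ ∘ curve⁻¹` are tight
along the mesh filter `𝓝[>] 0` (`IsTightAlongMesh`). -/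
def YBTight : Prop :=
  ∀ (D : DobrushinDomain) (a b : ℝ → MidEdge),
    IsYBEndpointApprox (fun (_ : ℤ) => Real.pi / 2) D a b →
    IsTightAlongMesh
      (fun δ (γ : YangBaxterSAW (fun (_ : ℤ) => Real.pi / 2) D.carrier δ (a δ) (b δ)) =>
        γ.curve (fun (_ : ℤ) => Real.pi / 2) δ)
      (fun δ => ybLaw (fun (_ : ℤ) => Real.pi / 2) D.carrier δ 1 (a δ) (b δ))

/-- **(I) Identification of the subsequential limits.** Every probability measure on `CurveClass ℂ`
that is a subsequential weak limit law of the `π/2` Yang–Baxter curve laws is the chordal SLE(8/3)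
law of the domain. -/
def YBSubseqIdentification : Prop :=
  ∀ (D : DobrushinDomain) (a b : ℝ → MidEdge),
    IsYBEndpointApprox (fun (_ : ℤ) => Real.pi / 2) D a b →
    ∀ μ : Measure (CurveClass ℂ), IsProbabilityMeasure μ →
      IsSubseqLimitLaw
        (fun δ (γ : YangBaxterSAW (fun (_ : ℤ) => Real.pi / 2) D.carrier δ (a δ) (b δ)) =>
          γ.curve (fun (_ : ℤ) => Real.pi / 2) δ)
        (fun δ => ybLaw (fun (_ : ℤ) => Real.pi / 2) D.carrier δ 1 (a δ) (b δ)) μ →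
      IsSLELaw ((8 : NNReal) / 3) D μ

/-- **(C) The convergence criterion for GM's `π/2` walk.** Tightness along the mesh + identification
of the probability subsequential limit laws ⇒ `ConvergesInLawToSLE (8/3)`. -/
def YBCriterion : Prop :=
  ∀ (D : DobrushinDomain) (a b : ℝ → MidEdge),
    IsYBEndpointApprox (fun (_ : ℤ) => Real.pi / 2) D a b →
    IsTightAlongMesh
      (fun δ (γ : YangBaxterSAW (fun (_ : ℤ) => Real.pi / 2) D.carrier δ (a δ) (b δ)) =>
        γ.curve (fun (_ : ℤ) => Real.pi / 2) δ)
      (fun δ => ybLaw (fun (_ : ℤ) => Real.pi / 2) D.carrier δ 1 (a δ) (b δ)) →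
    (∀ μ : Measure (CurveClass ℂ), IsProbabilityMeasure μ →
      IsSubseqLimitLaw
        (fun δ (γ : YangBaxterSAW (fun (_ : ℤ) => Real.pi / 2) D.carrier δ (a δ) (b δ)) =>
          γ.curve (fun (_ : ℤ) => Real.pi / 2) δ)
        (fun δ => ybLaw (fun (_ : ℤ) => Real.pi / 2) D.carrier δ 1 (a δ) (b δ)) μ →
      IsSLELaw ((8 : NNReal) / 3) D μ) →
    ConvergesInLawToSLE ((8 : NNReal) / 3) D
      (fun δ (γ : YangBaxterSAW (fun (_ : ℤ) => Real.pi / 2) D.carrier δ (a δ) (b δ)) =>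
        γ.curve (fun (_ : ℤ) => Real.pi / 2) δ)
      (fun δ => ybLaw (fun (_ : ℤ) => Real.pi / 2) D.carrier δ 1 (a δ) (b δ))

/-! ## Registered stubs (signatures spelled out over tree declarations only; the ONLY `sorry`s) -/

/-- **T1 (OPEN; the a-priori estimate) — the Aizenman–Burchard multi-traversal bound for GM's critical
`π/2` Yang–Baxter walk**: hypothesis (H1) of `isTightMeasureSet_of_traversalBounds` for the laws
`ybLaw (π/2) D.carrier δ 1 (a δ) (b δ)` and the drawn paths `⟨γ.path (π/2) δ⟩` (whose class is
`γ.curve (π/2) δ` by `rfl`): a shell-dependent threshold `k x ρ R`, constants `K ≥ 0`, `λ > 2`, and a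
mesh threshold `δ₀ > 0` such that for `δ ∈ (0, δ₀]` and `δ ≤ ρ < R ≤ 1` the probability of `k x ρ R`
separate traversals of the shell `D(x; ρ, R)` is `≤ K (ρ/R)^λ`. Shape = items `SAWTraversalBound` (δℤ²),
`HexTraversalBound` (δℍ). Why open: no annulus-crossing bound is known for any critical SAW-type model
(n = 0: no FKG/RSW; only bridge decay `GlazmanManolescu2019_thm2_holds` and sub-ballisticity exist).
Caveat (module docstring): with the shell-dependent `k` this is EQUIVALENT to tightness (T1 ⇔ T). -/
theorem stub_ybTraversalBound :
    ∀ (D : DobrushinDomain) (a b : ℝ → MidEdge),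
      IsYBEndpointApprox (fun (_ : ℤ) => Real.pi / 2) D a b →
      ∃ (k : ℂ → ℝ → ℝ → ℕ) (K lam δ₀ : ℝ), 0 ≤ K ∧ 2 < lam ∧ 0 < δ₀ ∧
        ∀ δ ∈ Set.Ioc (0 : ℝ) δ₀, ∀ (x : ℂ) (ρ R : ℝ), δ ≤ ρ → ρ < R → R ≤ 1 →
          ybLaw (fun (_ : ℤ) => Real.pi / 2) D.carrier δ 1 (a δ) (b δ)
              {γ | (⟨γ.path (fun (_ : ℤ) => Real.pi / 2) δ⟩ : Curve ℂ).HasTraversals (k x ρ R) x ρ R} ≤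
            ENNReal.ofReal (K * (ρ / R) ^ lam) := by
  sorry

/-- **T2 (LANDED, p144902, `Theorems/SAWCompassLatticeCompassSLEYbTightOfTraversalBound.lean`) —
traversal bound ⇒ tightness along the mesh** for GM's `π/2` walk: the PROVED Aizenman–Burchard
criterion `isTightMeasureSet_of_traversalBounds` (container = a closed ball around `D`, `d = 2`,
short-distance cutoff `TightOfTraversalBound.not_hasTraversals_path` with threshold 147 for mesh-`δ`
polylines through pairwise distinct mid-edge midpoints of the square tiling), then
`isTightAlongMesh_of_isTightMeasureSet_image`. Closed alias of the landed theorem. -/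
theorem stub_ybTightOfTraversalBound :
    ∀ (D : DobrushinDomain) (a b : ℝ → MidEdge),
      IsYBEndpointApprox (fun (_ : ℤ) => Real.pi / 2) D a b →
      (∃ (k : ℂ → ℝ → ℝ → ℕ) (K lam δ₀ : ℝ), 0 ≤ K ∧ 2 < lam ∧ 0 < δ₀ ∧
        ∀ δ ∈ Set.Ioc (0 : ℝ) δ₀, ∀ (x : ℂ) (ρ R : ℝ), δ ≤ ρ → ρ < R → R ≤ 1 →
          ybLaw (fun (_ : ℤ) => Real.pi / 2) D.carrier δ 1 (a δ) (b δ)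
              {γ | (⟨γ.path (fun (_ : ℤ) => Real.pi / 2) δ⟩ : Curve ℂ).HasTraversals (k x ρ R) x ρ R} ≤
            ENNReal.ofReal (K * (ρ / R) ^ lam)) →
      IsTightAlongMesh
        (fun δ (γ : YangBaxterSAW (fun (_ : ℤ) => Real.pi / 2) D.carrier δ (a δ) (b δ)) =>
          γ.curve (fun (_ : ℤ) => Real.pi / 2) δ)
        (fun δ => ybLaw (fun (_ : ℤ) => Real.pi / 2) D.carrier δ 1 (a δ) (b δ)) :=
  Summit.CriticalPhenomena.SAWScalingLimit.Theorems.SAWCompassLatticeCompassSLE.stub_ybTightOfTraversalBound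

/-- **I1 (OPEN; the conformal content) — the Lawler–Schramm–Werner `5/8` restriction law for GM's
critical `π/2` Yang–Baxter walk** (LSW03 arXiv:math/0209343 Thm. 6.1 predicts the value; the GM weights
are products of local face weights, so the law has the EXACT domain-restriction property and the
statement reads `Z(Ω'_δ; a, b)/Z(Ω_δ; a, b) → Φ'_A(0)^{5/8}`). For every Dobrushin `D`, hull subdomain
`D'` (ε-ball form), port endpoint approximation `(a_δ, b_δ)`, chordal uniformizer `φ` and restriction
data `(Φ, d)` of `φ.pullbackHull D'`: `P^{YB}_δ(range ⊆ closure D') → ENNReal.ofReal (d ^ (5/8))` as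
`δ → 0⁺`. The `π/2` twin of items stmt-7147 (`HexRestrictionLaw`) / stmt-4981 (`AvoidanceLimit`).
Barrier: `Literature.Barriers.CriticalPhenomena.ParafermionicHalfCauchyRiemann` bites any derivation from
the port parafermion alone. -/
theorem stub_ybRestrictionLaw :
    ∀ (D D' : DobrushinDomain) (a b : ℝ → MidEdge),
      IsYBEndpointApprox (fun (_ : ℤ) => Real.pi / 2) D a b →
      D'.carrier ⊆ D.carrier → D'.pt 0 = D.pt 0 → D'.pt 1 = D.pt 1 →
      (∃ ε : ℝ, 0 < ε ∧ D'.carrier ∩ Metric.ball (D.pt 0) ε = D.carrier ∩ Metric.ball (D.pt 0) ε ∧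
        D'.carrier ∩ Metric.ball (D.pt 1) ε = D.carrier ∩ Metric.ball (D.pt 1) ε) →
      ∀ (φ : ConformalEquiv upperHalfPlaneSet D.carrier), D.IsChordalUniformizing φ →
      ∀ (Φ : ConformalEquiv (upperHalfPlaneSet \ φ.pullbackHull D') upperHalfPlaneSet) (d : ℝ),
        IsRestrictionMap (φ.pullbackHull D') Φ → HasRestrictionDeriv (φ.pullbackHull D') Φ d →
        Tendsto (fun δ => ((ybLaw (fun (_ : ℤ) => Real.pi / 2) D.carrier δ 1 (a δ) (b δ)).map
            (fun γ => γ.curve (fun (_ : ℤ) => Real.pi / 2) δ))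
            (CurveClass.rangeSubset (closure D'.carrier)))
          (𝓝[>] (0 : ℝ)) (𝓝 (ENNReal.ofReal (d ^ ((5 : ℝ) / 8)))) := by
  sorry

/-- **I2a (LANDED, p144900, `Theorems/SAWCompassLatticeCompassSLEYbSubseqLimitChordal.lean`) —
probability subsequential limit laws of GM's critical `π/2` Yang–Baxter walk are CHORDAL**: `ν`-a.e.
curve class starts at `a = D.pt 0`, ends at `b = D.pt 1` and has range in `closure D` (portmanteau on
the closed events `{dist(source,a) ≤ η} ∩ {dist(target,b) ≤ η} ∩ {range ⊆ cl D}`; the drawn walks start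
at `δ·planeMidpoint (a δ) → a`, end at `δ·planeMidpoint (b δ) → b`, and lie in `D` once `a δ ≠ b δ`).
Closed alias of the landed theorem. -/
theorem stub_ybSubseqLimitChordal :
    ∀ (D : DobrushinDomain) (a b : ℝ → MidEdge),
      IsYBEndpointApprox (fun (_ : ℤ) => Real.pi / 2) D a b →
      ∀ (s : ℕ → ℝ) (ν : Measure (CurveClass ℂ)), Tendsto s atTop (𝓝[>] (0 : ℝ)) →
        IsProbabilityMeasure ν →
        (∀ f : BoundedContinuousFunction (CurveClass ℂ) ℝ,
          Tendsto (fun n => ∫ γ, f (γ.curve (fun (_ : ℤ) => Real.pi / 2) (s n))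
              ∂(ybLaw (fun (_ : ℤ) => Real.pi / 2) D.carrier (s n) 1 (a (s n)) (b (s n))))
            atTop (𝓝 (∫ x, f x ∂ν))) →
        ∀ᵐ γ ∂ν, γ.source = D.pt 0 ∧ γ.target = D.pt 1 ∧ γ.range ⊆ closure D.carrier :=
  Summit.CriticalPhenomena.SAWScalingLimit.Theorems.SAWCompassLatticeCompassSLE.stub_ybSubseqLimitChordal

/-- **I2b (OPEN; the irreducible lattice regularity estimate) — probability subsequential limit laws
of GM's critical `π/2` Yang–Baxter walk are carried by SIMPLE curves** (a uniform-in-mesh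
no-macroscopic-near-self-touching estimate; `CurveClass.simple` is not closed, nothing soft gives it).
The `π/2` twin of the hard core of items stmt-7148 (`HexSimpleSubseqLimits`) / stmt-4982
(`SimpleSubseqLimits`; on `δℤ²`, given tightness and the avoidance values, `SimpleSubseqLimits ↔
PastFutureAvoidance`, `FarPast.RouteResidual.crux_iff_pastFutureAvoidance` — research-open). The
boundary-avoidance clause of the carrier is NOT part of this stub (it is derived in the composition). -/
theorem stub_ybSubseqLimitSimple :
    ∀ (D : DobrushinDomain) (a b : ℝ → MidEdge),
      IsYBEndpointApprox (fun (_ : ℤ) => Real.pi / 2) D a b →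
      ∀ (s : ℕ → ℝ) (ν : Measure (CurveClass ℂ)), Tendsto s atTop (𝓝[>] (0 : ℝ)) →
        IsProbabilityMeasure ν →
        (∀ f : BoundedContinuousFunction (CurveClass ℂ) ℝ,
          Tendsto (fun n => ∫ γ, f (γ.curve (fun (_ : ℤ) => Real.pi / 2) (s n))
              ∂(ybLaw (fun (_ : ℤ) => Real.pi / 2) D.carrier (s n) 1 (a (s n)) (b (s n))))
            atTop (𝓝 (∫ x, f x ∂ν))) →
        ∀ᵐ γ ∂ν, γ ∈ CurveClass.simple := by
  sorry

/-- **I3 (LANDED, p144241, `Theorems/SAWCompassLatticeCompassSLEYbAvoidancePassage.lean`) — the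
portmanteau sandwich for GM's `π/2` walk**: if `ν` is the weak limit of the pushed-forward laws along
`s_n → 0⁺`, `μ` an SLE(8/3) law of `D`, and along `s_n` the lattice avoidance probabilities of EVERY hull
subdomain `D''` converge to `μ(range ⊆ closure D'')`, then `ν(range ⊆ closure D') = μ(range ⊆ closure D')`
for every hull subdomain `D'`. Closed alias of the landed theorem. -/
theorem stub_ybAvoidancePassage :
    ∀ (D : DobrushinDomain) (a b : ℝ → MidEdge),
      IsYBEndpointApprox (fun (_ : ℤ) => Real.pi / 2) D a b →
      ∀ (s : ℕ → ℝ) (ν μ : Measure (CurveClass ℂ)), Tendsto s atTop (𝓝[>] (0 : ℝ)) →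
        IsProbabilityMeasure ν →
        (∀ f : BoundedContinuousFunction (CurveClass ℂ) ℝ,
          Tendsto (fun n => ∫ γ, f (γ.curve (fun (_ : ℤ) => Real.pi / 2) (s n))
              ∂(ybLaw (fun (_ : ℤ) => Real.pi / 2) D.carrier (s n) 1 (a (s n)) (b (s n))))
            atTop (𝓝 (∫ x, f x ∂ν))) →
        IsSLELaw ((8 : NNReal) / 3) D μ →
        (∀ D' : DobrushinDomain, D'.carrier ⊆ D.carrier → D'.pt 0 = D.pt 0 → D'.pt 1 = D.pt 1 →
          (∃ ε : ℝ, 0 < ε ∧ D'.carrier ∩ Metric.ball (D.pt 0) ε = D.carrier ∩ Metric.ball (D.pt 0) ε ∧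
            D'.carrier ∩ Metric.ball (D.pt 1) ε = D.carrier ∩ Metric.ball (D.pt 1) ε) →
          Tendsto (fun n => ((ybLaw (fun (_ : ℤ) => Real.pi / 2) D.carrier (s n) 1 (a (s n)) (b (s n))).map
              (fun γ => γ.curve (fun (_ : ℤ) => Real.pi / 2) (s n)))
              (CurveClass.rangeSubset (closure D'.carrier)))
            atTop (𝓝 (μ (CurveClass.rangeSubset (closure D'.carrier))))) →
        ∀ D' : DobrushinDomain, D'.carrier ⊆ D.carrier → D'.pt 0 = D.pt 0 → D'.pt 1 = D.pt 1 →
          (∃ ε : ℝ, 0 < ε ∧ D'.carrier ∩ Metric.ball (D.pt 0) ε = D.carrier ∩ Metric.ball (D.pt 0) ε ∧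
            D'.carrier ∩ Metric.ball (D.pt 1) ε = D.carrier ∩ Metric.ball (D.pt 1) ε) →
          ν (CurveClass.rangeSubset (closure D'.carrier)) =
            μ (CurveClass.rangeSubset (closure D'.carrier)) :=
  Summit.CriticalPhenomena.SAWScalingLimit.Theorems.SAWCompassLatticeCompassSLE.stub_ybAvoidancePassage

/-- **C (LANDED, p143596, `Theorems/SAWCompassLatticeCompassSLEYbCriterion.lean`) = `YBCriterion`.** The
soft step for this model: tightness along the mesh + identification ⇒ `ConvergesInLawToSLE (8/3)` for
`ybLaw (π/2)` (eventual probability of `ybLaw` via the port dictionary, Dirac patching of the junk meshes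
on `CurveClass ℂ`, `convergesInLawToSLE_of_isTightAlongMesh`, `IsSLECurve.map_eq_holds`). Kept here as a
closed alias of the landed theorem so that the registered stub list stays complete. -/
theorem stub_ybCriterion :
    ∀ (D : DobrushinDomain) (a b : ℝ → MidEdge),
      IsYBEndpointApprox (fun (_ : ℤ) => Real.pi / 2) D a b →
      IsTightAlongMesh
        (fun δ (γ : YangBaxterSAW (fun (_ : ℤ) => Real.pi / 2) D.carrier δ (a δ) (b δ)) =>
          γ.curve (fun (_ : ℤ) => Real.pi / 2) δ)
        (fun δ => ybLaw (fun (_ : ℤ) => Real.pi / 2) D.carrier δ 1 (a δ) (b δ)) →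
      (∀ μ : Measure (CurveClass ℂ), IsProbabilityMeasure μ →
        IsSubseqLimitLaw
          (fun δ (γ : YangBaxterSAW (fun (_ : ℤ) => Real.pi / 2) D.carrier δ (a δ) (b δ)) =>
            γ.curve (fun (_ : ℤ) => Real.pi / 2) δ)
          (fun δ => ybLaw (fun (_ : ℤ) => Real.pi / 2) D.carrier δ 1 (a δ) (b δ)) μ →
        IsSLELaw ((8 : NNReal) / 3) D μ) →
      ConvergesInLawToSLE ((8 : NNReal) / 3) D
        (fun δ (γ : YangBaxterSAW (fun (_ : ℤ) => Real.pi / 2) D.carrier δ (a δ) (b δ)) =>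
          γ.curve (fun (_ : ℤ) => Real.pi / 2) δ)
        (fun δ => ybLaw (fun (_ : ℤ) => Real.pi / 2) D.carrier δ 1 (a δ) (b δ)) :=
  Summit.CriticalPhenomena.SAWScalingLimit.Theorems.SAWCompassLatticeCompassSLE.stub_ybCriterion

/-! ## Closed pieces landed by lead c6 (lattice halves of I1 and I2b; registered, `--supports` 6965) -/

/-- **I1-lattice (LANDED, p159708, `Theorems/SAWCompassLatticeCompassSLEYbDomainRestriction.lean`) — the
partition-function sandwich for the event of stub I1.** For every angle sequence `Θ`, domains `Ω' ⊆ Ω`,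
mesh `δ ≥ 0` and mid-edges `a ≠ b`, the pushed-forward Yang–Baxter law of `Ω_δ` gives the closed event
`{range ⊆ closure Ω'}` a probability between `G_{Ω'_δ}(a,b)/G_{Ω_δ}(a,b)` and
`G_{(Ω ∩ cthickening (2δ) Ω')_δ}(a,b)/G_{Ω_δ}(a,b)` (exact domain-restriction property of the GM weights:
`ybLaw_setOf_facesVisited`, `map_mapDomain_ybLaw`). Closed alias of the landed theorem. -/
theorem stub_ybRestrictionSandwich :
    ∀ (Θ : ℤ → ℝ) (Ω Ω' : Set ℂ) (δ : ℝ) (a b : MidEdge), Ω' ⊆ Ω → 0 ≤ δ → a ≠ b →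
      ((ybLaw Θ Ω δ 1 a b).map (fun γ => γ.curve Θ δ)) (CurveClass.rangeSubset (closure Ω')) ∈
        Set.Icc (twoPoint (meshFaces Θ Ω' δ) Θ a b / twoPoint (meshFaces Θ Ω δ) Θ a b)
          (twoPoint (meshFaces Θ (Ω ∩ Metric.cthickening (2 * δ) Ω') δ) Θ a b /
            twoPoint (meshFaces Θ Ω δ) Θ a b) :=
  Summit.CriticalPhenomena.SAWScalingLimit.Theorems.SAWCompassLatticeCompassSLE.stub_ybRestrictionSandwich

/-- **I2b-lattice-1 (LANDED, p160797, `Theorems/SAWCompassLatticeCompassSLEYbPolylineSimple.lean`) — planar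
polyline simplicity criterion**: a planar polyline with distinct consecutive vertices, distinct first and last
vertex, whose segments pairwise meet at most in "end of the earlier = start of the later", is a simple curve
class (`Curve.IsFlat` gluing along `Path.trans` + monotone–light factorisation). Closed alias. -/
theorem stub_ybPolylineSimpleCriterion :
    ∀ (a b : ℂ) (l : List ℂ), List.IsChain (· ≠ ·) (a :: b :: l) →
      ((a :: b :: l).zip (b :: l)).Pairwise
        (fun p q => segment ℝ p.1 p.2 ∩ segment ℝ q.1 q.2 ⊆ {p.2} ∩ {q.1}) →
      a ≠ (a :: b :: l).getLast (List.cons_ne_nil _ _) →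
      CurveClass.mk ⟨polyline (a :: b :: l)⟩ ∈ (CurveClass.simple : Set (CurveClass ℂ)) :=
  Summit.CriticalPhenomena.SAWScalingLimit.Theorems.SAWCompassLatticeCompassSLE.stub_ybPolylineSimpleCriterion

/-- **I2b-lattice-2 (LANDED, p161476, `Theorems/SAWCompassLatticeCompassSLEYbLatticeSimple.lean`) — GM `π/2` walks
are drawn as SIMPLE curves**: for `a ≠ b`, `δ ≠ 0` and any set of faces, `γ.curve (π/2) δ ∈ CurveClass.simple`
(square-tiling geometry of GM Fig. 1: arcs of different squares meet only at common ends, the two non-crossing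
arcs of one square are disjoint; `nodup` + `isChain` + `noncross`). Closed alias. -/
theorem stub_ybCurveSimple :
    ∀ (D : Set Face) (a b : MidEdge) (γ : YBWalk D a b), a ≠ b → ∀ δ : ℝ, δ ≠ 0 →
      γ.curve (fun (_ : ℤ) => Real.pi / 2) δ ∈ (CurveClass.simple : Set (CurveClass ℂ)) :=
  Summit.CriticalPhenomena.SAWScalingLimit.Theorems.SAWCompassLatticeCompassSLE.stub_ybCurveSimple

/-- **I2b-soft (LANDED, `Theorems/SAWCompassLatticeCompassSLEYbSubseqLimitClosureSimple.lean`) — probability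
subsequential limits of GM's critical `π/2` walk are carried by `closure CurveClass.simple`** (portmanteau on the
closed set, which has lattice probability one once `a (s n) ≠ b (s n)`, `s n > 0`, by `stub_ybCurveSimple`). What
is left of the open stub I2b is `ν (closure simple ∖ simple) = 0` (no self-touching). Closed alias. -/
theorem stub_ybSubseqLimitClosureSimple :
    ∀ (D : DobrushinDomain) (a b : ℝ → MidEdge),
      IsYBEndpointApprox (fun (_ : ℤ) => Real.pi / 2) D a b →
      ∀ (s : ℕ → ℝ) (ν : Measure (CurveClass ℂ)), Tendsto s atTop (𝓝[>] (0 : ℝ)) →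
        IsProbabilityMeasure ν →
        (∀ f : BoundedContinuousFunction (CurveClass ℂ) ℝ,
          Tendsto (fun n => ∫ γ, f (γ.curve (fun (_ : ℤ) => Real.pi / 2) (s n))
              ∂(ybLaw (fun (_ : ℤ) => Real.pi / 2) D.carrier (s n) 1 (a (s n)) (b (s n))))
            atTop (𝓝 (∫ x, f x ∂ν))) →
        ∀ᵐ γ ∂ν, γ ∈ closure (CurveClass.simple : Set (CurveClass ℂ)) :=
  Summit.CriticalPhenomena.SAWScalingLimit.Theorems.SAWCompassLatticeCompassSLE.stub_ybSubseqLimitClosureSimple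

/-! ## The compositions (kernel-checked; no `sorry` outside the stubs) -/

/-- **T from T1 + T2** (pure logic). -/
theorem ybTight_holds : YBTight :=
  fun D a b hab => stub_ybTightOfTraversalBound D a b hab (stub_ybTraversalBound D a b hab)

/-- **I from I1 + I2a + I2b + I3** — the Lawler–Schramm–Werner restriction programme for GM's `π/2` walk
(port of `Cruxes/HexSubseqIdentification/Lines/birth.lean`, `HexSubseqIdentification_of`, reordered so
that the boundary clause of the carrier of `ν` is DERIVED): realise the chordal SLE(8/3) law `μ` of
`(D; a, b)` and its simple-chord carrier; fix a chordal uniformizer `φ`; for every hull subdomain `D'` build the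
`*`-hull `φ.pullbackHull D'` with restriction data `(Φ, d)` and combine I1 (composed with `s_n → 0⁺`)
with the SLE value `μ(range ⊆ cl D') = d^{5/8}` to get convergence of the lattice avoidance
probabilities to the SLE values; I3 upgrades this to `ν = μ` on all hull-avoidance events; the carrier
of `ν` is chordal (I2a), hence boundary-avoiding (`stub_rangeIsArc_boundary`), and simple (I2b); and
avoidance determines the law: `ν = μ`, an SLE(8/3) law. -/
theorem ybSubseqIdentification_holds : YBSubseqIdentification := by
  intro D a b hab ν hν hsub
  obtain ⟨s, hs, hlim⟩ := hsub
  classical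
  -- the chordal SLE(8/3) law `μ` of `(D; a, b)` (existence PROVED: Rohde–Schramm trace + transience)
  obtain ⟨μ, hμ⟩ : ∃ μ : Measure (CurveClass ℂ), IsSLELaw ((8 : ℝ≥0) / 3) D μ := by
    obtain ⟨Γ, hΓ⟩ := exists_isSLECurve_eightThirds D
    exact ⟨_, hΓ.isSLELaw_map⟩
  -- its carrier (PROVED item stmt-4985)
  obtain ⟨hμP, hμcar⟩ :=
    _root_.Summit.CriticalPhenomena.SAWScalingLimit.Theorems.SLECarrier_proof D μ hμ
  haveI : IsProbabilityMeasure ν := hν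
  -- a chordal uniformizing map `φ : (ℍ; 0, ∞) → (D; a, b)` (Riemann + Carathéodory, PROVED)
  obtain ⟨φ, hφ⟩ := MarkedDomain.exists_isChordalUniformizing_holds D
  -- along `s`, the lattice avoidance probability of every hull subdomain tends to its SLE(8/3) value
  have hconv : ∀ D' : DobrushinDomain, D'.carrier ⊆ D.carrier → D'.pt 0 = D.pt 0 → D'.pt 1 = D.pt 1 →
      (∃ ε : ℝ, 0 < ε ∧ D'.carrier ∩ Metric.ball (D.pt 0) ε = D.carrier ∩ Metric.ball (D.pt 0) ε ∧
        D'.carrier ∩ Metric.ball (D.pt 1) ε = D.carrier ∩ Metric.ball (D.pt 1) ε) →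
      Tendsto (fun n => ((ybLaw (fun (_ : ℤ) => Real.pi / 2) D.carrier (s n) 1 (a (s n)) (b (s n))).map
          (fun γ => γ.curve (fun (_ : ℤ) => Real.pi / 2) (s n)))
          (CurveClass.rangeSubset (closure D'.carrier)))
        atTop (𝓝 (μ (CurveClass.rangeSubset (closure D'.carrier)))) := by
    intro D' hsub' h0 h1 hε
    -- `D'` is a hull subdomain, so `A = φ.pullbackHull D'` is a `*`-hull with restriction data `(Φ, d)`
    have hHull : D.IsHullSubdomain D' :=
      _root_.Summit.CriticalPhenomena.SAWScalingLimit.Theorems.IsingBoundaryRatio.Negative.isHullSubdomain_of_conds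
        hsub' h0 h1 hε
    have hA : IsStarHull (φ.pullbackHull D') :=
      IsStarHull.pullbackHull JordanDomain.isSimplyConnected_holds hφ hHull
    obtain ⟨Φ, hΦ⟩ := hA.exists_isRestrictionMap
    obtain ⟨d, -, -, hd⟩ := IsStarHull.exists_hasRestrictionDeriv_holds hA hΦ
    -- I1 along the full filter `𝓝[>] 0`, and the SLE(8/3) value (PROVED item stmt-4986)
    have hlat := stub_ybRestrictionLaw D D' a b hab hsub' h0 h1 hε φ hφ Φ d hΦ hd
    have hval : μ (CurveClass.rangeSubset (closure D'.carrier)) = ENNReal.ofReal (d ^ ((5 : ℝ) / 8)) :=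
      _root_.Summit.CriticalPhenomena.SAWScalingLimit.Theorems.SLEAvoidanceValue_pullbackHull_proof
        D D' μ hμ hsub' h0 h1 hε φ hφ Φ d hΦ hd
    rw [hval]
    exact hlat.comp hs
  -- I3: `ν` and `μ` agree on every hull-avoidance event (this never uses the carrier of `ν`)
  have hagree := stub_ybAvoidancePassage D a b hab s ν μ hs hν hlim hμ hconv
  -- the carrier of `ν`: chordal (I2a), boundary-avoiding (from the agreement, lattice-free LANDED
  -- theorem `stub_rangeIsArc_boundary` of the `δℤ²` simplicity programme), simple (I2b)
  have hsoft : ∀ᵐ γ ∂ν, γ.source = D.pt 0 ∧ γ.target = D.pt 1 ∧ γ.range ⊆ closure D.carrier :=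
    stub_ybSubseqLimitChordal D a b hab s ν hs hν hlim
  have hfr : ∀ᵐ γ ∂ν, γ.range ∩ frontier D.carrier ⊆ {D.pt 0, D.pt 1} :=
    _root_.Summit.CriticalPhenomena.SAWScalingLimit.Theorems.SimpleSubseqLimits.MarkedPointRevisit.ArcRangeBoundary.stub_rangeIsArc_boundary
      D ν μ hν hμP hsoft hμcar hagree
  have hsimple : ∀ᵐ γ ∂ν, γ ∈ CurveClass.simple := stub_ybSubseqLimitSimple D a b hab s ν hs hν hlim
  have hνcar : ∀ᵐ γ ∂ν, γ ∈ CurveClass.simple ∧ γ.source = D.pt 0 ∧ γ.target = D.pt 1 ∧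
      γ.range ⊆ closure D.carrier ∧ γ.range ∩ frontier D.carrier ⊆ {D.pt 0, D.pt 1} := by
    filter_upwards [hsimple, hsoft, hfr] with γ h1 h2 h3
    exact ⟨h1, h2.1, h2.2.1, h2.2.2, h3⟩
  -- avoidance determines the law (PROVED item stmt-1373): `ν = μ`
  have heq : ν = μ :=
    _root_.Summit.CriticalPhenomena.SAWScalingLimit.Theorems.AvoidanceDeterminesLaw.AvoidanceDeterminesLaw_proof
      D ν μ hν hμP hνcar hμcar hagree
  rw [heq]
  exact hμ

/-- **C, named** (definitionally the registered stub). -/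
theorem ybCriterion_holds : YBCriterion := stub_ybCriterion

/-- **Explicit-binder composition**: the three v1 statements give `YBSquareSLE`
(stmt-CriticalPhenomena-6967), pointwise in the Dobrushin domain and the endpoint approximation. -/
theorem ybSquareSLE_of_stubs (hT : YBTight) (hI : YBSubseqIdentification) (hC : YBCriterion) :
    SAWCompassLattice.YBSquareSLE :=
  fun D a b hab => hC D a b hab (hT D a b hab) (hI D a b hab)

/-- **The skeleton closes the crux modulo its stubs**: `CompassSLE` (stmt-CriticalPhenomena-6965) from the
six stubs, through `YBSquareSLE` and the LANDED port transfer + port dictionary of line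
`HexTransfer/Sketch` (`stub_portTransfer`, `stub_portDictionary` — sorry-free theorems of the tree,
despite their historical names). -/
theorem CompassSLE_of : SAWCompassLattice.CompassSLE :=
  Summit.CriticalPhenomena.SAWScalingLimit.Cruxes.HexTransfer.Sketch.stub_portTransfer
    Summit.CriticalPhenomena.SAWScalingLimit.Cruxes.HexTransfer.Sketch.stub_portDictionary
    (ybSquareSLE_of_stubs ybTight_holds ybSubseqIdentification_holds ybCriterion_holds)

/-! ## Exactness (LANDED, lead c2): the crux is EXACTLY the conjunction of its three open stubs -/

/-- **(T1) as a proposition**: the registered signature of `stub_ybTraversalBound`, verbatim. -/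
def YBTraversalBound : Prop :=
  ∀ (D : DobrushinDomain) (a b : ℝ → MidEdge),
    IsYBEndpointApprox (fun (_ : ℤ) => Real.pi / 2) D a b →
    ∃ (k : ℂ → ℝ → ℝ → ℕ) (K lam δ₀ : ℝ), 0 ≤ K ∧ 2 < lam ∧ 0 < δ₀ ∧
      ∀ δ ∈ Set.Ioc (0 : ℝ) δ₀, ∀ (x : ℂ) (ρ R : ℝ), δ ≤ ρ → ρ < R → R ≤ 1 →
        ybLaw (fun (_ : ℤ) => Real.pi / 2) D.carrier δ 1 (a δ) (b δ)
            {γ | (⟨γ.path (fun (_ : ℤ) => Real.pi / 2) δ⟩ : Curve ℂ).HasTraversals (k x ρ R) x ρ R} ≤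
          ENNReal.ofReal (K * (ρ / R) ^ lam)

/-- **(I1) as a proposition**: the registered signature of `stub_ybRestrictionLaw`, verbatim. -/
def YBRestrictionLaw : Prop :=
  ∀ (D D' : DobrushinDomain) (a b : ℝ → MidEdge),
    IsYBEndpointApprox (fun (_ : ℤ) => Real.pi / 2) D a b →
    D'.carrier ⊆ D.carrier → D'.pt 0 = D.pt 0 → D'.pt 1 = D.pt 1 →
    (∃ ε : ℝ, 0 < ε ∧ D'.carrier ∩ Metric.ball (D.pt 0) ε = D.carrier ∩ Metric.ball (D.pt 0) ε ∧
      D'.carrier ∩ Metric.ball (D.pt 1) ε = D.carrier ∩ Metric.ball (D.pt 1) ε) →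
    ∀ (φ : ConformalEquiv upperHalfPlaneSet D.carrier), D.IsChordalUniformizing φ →
    ∀ (Φ : ConformalEquiv (upperHalfPlaneSet \ φ.pullbackHull D') upperHalfPlaneSet) (d : ℝ),
      IsRestrictionMap (φ.pullbackHull D') Φ → HasRestrictionDeriv (φ.pullbackHull D') Φ d →
      Tendsto (fun δ => ((ybLaw (fun (_ : ℤ) => Real.pi / 2) D.carrier δ 1 (a δ) (b δ)).map
          (fun γ => γ.curve (fun (_ : ℤ) => Real.pi / 2) δ))
          (CurveClass.rangeSubset (closure D'.carrier)))
        (𝓝[>] (0 : ℝ)) (𝓝 (ENNReal.ofReal (d ^ ((5 : ℝ) / 8))))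

/-- **(I2b) as a proposition**: the registered signature of `stub_ybSubseqLimitSimple`, verbatim. -/
def YBSubseqLimitSimple : Prop :=
  ∀ (D : DobrushinDomain) (a b : ℝ → MidEdge),
    IsYBEndpointApprox (fun (_ : ℤ) => Real.pi / 2) D a b →
    ∀ (s : ℕ → ℝ) (ν : Measure (CurveClass ℂ)), Tendsto s atTop (𝓝[>] (0 : ℝ)) →
      IsProbabilityMeasure ν →
      (∀ f : BoundedContinuousFunction (CurveClass ℂ) ℝ,
        Tendsto (fun n => ∫ γ, f (γ.curve (fun (_ : ℤ) => Real.pi / 2) (s n))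
            ∂(ybLaw (fun (_ : ℤ) => Real.pi / 2) D.carrier (s n) 1 (a (s n)) (b (s n))))
          atTop (𝓝 (∫ x, f x ∂ν))) →
      ∀ᵐ γ ∂ν, γ ∈ CurveClass.simple

/-- **The crux is EXACTLY its three open stubs** (LANDED `compassSLE_iff_stubs`, p152168):
`CompassSLE ↔ T1 ∧ I1 ∧ I2b`. -/
theorem compassSLE_iff_openStubs :
    SAWCompassLattice.CompassSLE ↔ YBTraversalBound ∧ YBRestrictionLaw ∧ YBSubseqLimitSimple :=
  Summit.CriticalPhenomena.SAWScalingLimit.Theorems.SAWCompassLatticeCompassSLE.compassSLE_iff_stubs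

/-- The three open stubs of this skeleton, bundled (they are its only `sorry`s). -/
theorem openStubs_hold : YBTraversalBound ∧ YBRestrictionLaw ∧ YBSubseqLimitSimple :=
  ⟨stub_ybTraversalBound, stub_ybRestrictionLaw, stub_ybSubseqLimitSimple⟩

/-- **Second, independent composition** of the crux from the stubs: through the landed exactness
theorem instead of the in-file composition `CompassSLE_of` (same three `sorry`s, nothing else). -/
theorem CompassSLE_of' : SAWCompassLattice.CompassSLE :=
  compassSLE_iff_openStubs.2 openStubs_hold

/- NOTE (lead c2). The LANDED cross-route reduction
`Summit.CriticalPhenomena.SAWScalingLimit.Theorems.SAWCompassLatticeCompassSLE.compassSLE_of_trackTransport :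
AngleUniversality → YBLimitExists → AxiomsOfLimit → RStarRot → MirrorRotation → CompassSLE` (p152168, sorry-free,
CONDITIONAL on the five cruxes stmt-16963/16995/16965/7298/16997 of route SAWTrackTransport) is deliberately NOT
restated in this skeleton: a theorem whose head symbol is the crux would be read by the skeleton checker as
"concludes the crux, closed", although it only proves an implication. Import the Theorems file to use it. -/

end Summit.CriticalPhenomena.SAWScalingLimit.Cruxes.CompassSLE.Birth

end
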